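import Summits.CriticalPhenomena.PercolationContinuityZ3.Theorems.PercNearOneGluingAdditiveGluingFibreContraction
import HarnessLib

/-!
# Crux `PercNearOneGluing.AdditiveGluing` (stmt-CriticalPhenomena-4576), line `tieline`:
# one-edge surgery for the fibre counts of (T) — inserting an edge, the summand in product form, splitting a fibre at an edge

Support file (`--supports stmt-CriticalPhenomena-4576`, helper, seat (d) exchange-certificate form, gen 8).  No named facts,
no sorries; the only definitions are bookkeeping abbreviations (a real `0/1` indicator `ir`, the real indicator `rch` of a
connection in one replica, the summand `summandT` of `fibreSumT` as a function of a replica triple, the generic fibre sum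
`fibreSumF` of a summand, and coordinate surgery `setAt` on triples).

Three reusable tools for the contraction analysis of the kernel's fibre counts (`…FibreContraction`, memo EXCHCERT-g8 §2):
* `reachable_insert_cases` / `reachable_insert_iff_of_not_reachable` / `reachable_insert_iff_of_reachable`: after inserting ONE
  edge `s(x, y)`, the open cluster of a vertex that reached neither endpoint is unchanged, and the cluster of a vertex that
  reached `x` becomes the union of the old clusters of itself and of `y`;
* `fibreSumT_eq_fibreSumF`: `fibreSumT o b u v c I` is the fibre sum of the explicit product summand
  `N₁·D₂·D₃·(ub₂ − ub₃)·(vo₃ − oc₁·vc₃)`;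
* `fibreSumF_split_one/two/three`: the fibre of a count vector `J` splits along the replica pattern at one coordinate `e`
  into copies of the fibre of `J[e ↦ 0]` (three for a solo or duo edge, one for a contracted edge), via `setAt e`.
The companion file `…FibreSeedStep` combines them into the exact contraction-step identity.
[folklore] (path surgery at one edge; re-indexing a finite sum along a bijection)
-/

namespace Summit.CriticalPhenomena.PercolationContinuityZ3.Cruxes.AdditiveGluing.TieLine.FibreCount

open MeasureTheory Set Finset Literature.Probability.Percolation

open Classical

/-! ### Reachability after inserting one edge -/

section ReachInsert

variable {V : Type*}

/-- Adding edges only adds open paths. [folklore] -/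
theorem reachable_insert_of_reachable {ω : Set (Sym2 V)} {e : Sym2 V} {p q : V} (h : (openGraph ω).Reachable p q) :
    (openGraph (insert e ω)).Reachable p q :=
  h.mono (BHK2006.openGraph_le (Set.subset_insert e ω))

/-- The endpoints of an inserted edge are joined. [folklore] -/
theorem reachable_insert_endpoints (ω : Set (Sym2 V)) (x y : V) : (openGraph (insert s(x, y) ω)).Reachable x y := by
  by_cases hxy : x = y
  · rw [hxy]
  · refine SimpleGraph.Adj.reachable ?_
    rw [openGraph_adj]
    exact ⟨Set.mem_insert _ _, hxy⟩

/-- **One-edge surgery.**  An open path in `ω ∪ {xy}` either avoids the new edge, or splits at it. [folklore] -/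
theorem reachable_insert_cases {ω : Set (Sym2 V)} {x y p q : V} (h : (openGraph (insert s(x, y) ω)).Reachable p q) :
    (openGraph ω).Reachable p q ∨
      (((openGraph ω).Reachable p x ∧ (openGraph ω).Reachable y q) ∨
        ((openGraph ω).Reachable p y ∧ (openGraph ω).Reachable x q)) := by
  rw [SimpleGraph.reachable_iff_reflTransGen] at h
  induction h with
  | refl => exact Or.inl (SimpleGraph.Reachable.refl p)
  | @tail b d _ hbd ih =>
    rw [openGraph_adj] at hbd
    obtain ⟨hmem, hne⟩ := hbd
    rcases Set.mem_insert_iff.1 hmem with heq | hω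
    · -- the last step uses the new edge
      rcases Sym2.eq_iff.1 heq with ⟨rfl, rfl⟩ | ⟨rfl, rfl⟩
      · -- b = x, d = y
        rcases ih with h1 | ⟨h2, _⟩ | ⟨h4, _⟩
        · exact Or.inr (Or.inl ⟨h1, SimpleGraph.Reachable.refl _⟩)
        · exact Or.inr (Or.inl ⟨h2, SimpleGraph.Reachable.refl _⟩)
        · exact Or.inl h4
      · -- b = y, d = x
        rcases ih with h1 | ⟨h2, _⟩ | ⟨h4, _⟩
        · exact Or.inr (Or.inr ⟨h1, SimpleGraph.Reachable.refl _⟩)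
        · exact Or.inl h2
        · exact Or.inr (Or.inr ⟨h4, SimpleGraph.Reachable.refl _⟩)
    · have hadj : (openGraph ω).Adj b d := by rw [openGraph_adj]; exact ⟨hω, hne⟩
      rcases ih with h1 | ⟨h2, h3⟩ | ⟨h4, h5⟩
      · exact Or.inl (h1.trans hadj.reachable)
      · exact Or.inr (Or.inl ⟨h2, h3.trans hadj.reachable⟩)
      · exact Or.inr (Or.inr ⟨h4, h5.trans hadj.reachable⟩)

/-- If `p` reaches neither endpoint of the new edge, its open cluster is unchanged. [folklore] -/
theorem reachable_insert_iff_of_not_reachable {ω : Set (Sym2 V)} {x y p : V} (hx : ¬ (openGraph ω).Reachable p x)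
    (hy : ¬ (openGraph ω).Reachable p y) (q : V) :
    (openGraph (insert s(x, y) ω)).Reachable p q ↔ (openGraph ω).Reachable p q := by
  refine ⟨fun h => ?_, reachable_insert_of_reachable⟩
  rcases reachable_insert_cases h with h1 | ⟨h2, _⟩ | ⟨h4, _⟩
  · exact h1
  · exact absurd h2 hx
  · exact absurd h4 hy

/-- If `p` reaches the endpoint `x` of the new edge, its new cluster is the union of the old clusters of `p` and `y`. [folklore] -/
theorem reachable_insert_iff_of_reachable {ω : Set (Sym2 V)} {x y p : V} (hx : (openGraph ω).Reachable p x) (q : V) :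
    (openGraph (insert s(x, y) ω)).Reachable p q ↔ (openGraph ω).Reachable p q ∨ (openGraph ω).Reachable y q := by
  constructor
  · intro h
    rcases reachable_insert_cases h with h1 | ⟨_, h3⟩ | ⟨_, h5⟩
    · exact Or.inl h1
    · exact Or.inr h3
    · exact Or.inl (hx.trans h5)
  · rintro (h1 | h2)
    · exact reachable_insert_of_reachable h1
    · exact (reachable_insert_of_reachable hx).trans ((reachable_insert_endpoints ω x y).trans (reachable_insert_of_reachable h2))

end ReachInsert

/-! ### Real indicators and the summand of (T) in product form -/

section Summand

/-- Real `0/1` indicator of a proposition (classical). [folklore] -/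
noncomputable def ir (P : Prop) : ℝ := @ite ℝ P (Classical.propDecidable P) 1 0

/-- `ir` of a true proposition. [folklore] -/
theorem ir_of_true {P : Prop} (h : P) : ir P = 1 := by unfold ir; rw [if_pos h]
/-- `ir` of a false proposition. [folklore] -/
theorem ir_of_false {P : Prop} (h : ¬ P) : ir P = 0 := by unfold ir; rw [if_neg h]

/-- `ir (P ∧ Q) = ir P * ir Q`. [folklore] -/
theorem ir_and (P Q : Prop) : ir (P ∧ Q) = ir P * ir Q := by
  by_cases hP : P <;> by_cases hQ : Q <;> simp [ir_of_true, ir_of_false, hP, hQ]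

/-- `ir (¬ P) = 1 - ir P`. [folklore] -/
theorem ir_not (P : Prop) : ir (¬ P) = 1 - ir P := by
  by_cases hP : P <;> simp [ir_of_true, ir_of_false, hP]

/-- `ir (P ∨ Q) = ir P + ir Q - ir P * ir Q`. [folklore] -/
theorem ir_or (P Q : Prop) : ir (P ∨ Q) = ir P + ir Q - ir P * ir Q := by
  by_cases hP : P <;> by_cases hQ : Q <;> simp [ir_of_true, ir_of_false, hP, hQ]

/-- `ir` respects `↔`. [folklore] -/
theorem ir_congr {P Q : Prop} (h : P ↔ Q) : ir P = ir Q := by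
  by_cases hP : P
  · rw [ir_of_true hP, ir_of_true (h.1 hP)]
  · rw [ir_of_false hP, ir_of_false (fun hQ => hP (h.2 hQ))]

variable {ι : Type*}

/-- The three-event indicator `ind` is the product of three real indicators. [folklore] -/
theorem ind_eq_ir (A B C : Set (Set ι)) (t : Triple ι) :
    ind A B C t = ir (cfg t.1 ∈ A) * ir (cfg t.2.1 ∈ B) * ir (cfg t.2.2 ∈ C) := by
  rw [← ir_and, ← ir_and]
  by_cases h : cfg t.1 ∈ A ∧ cfg t.2.1 ∈ B ∧ cfg t.2.2 ∈ C
  · rw [ir_of_true (and_assoc.2 h)]; unfold ind; rw [if_pos h]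
  · rw [ir_of_false (fun h' => h (and_assoc.1 h'))]; unfold ind; rw [if_neg h]

variable [Fintype ι]

/-- The generic signed fibre sum of a summand `F` at the count vector `I`. [folklore] -/
noncomputable def fibreSumF (F : Triple ι → ℝ) (I : ι → ℕ) : ℝ :=
  ∑ t ∈ (Finset.univ : Finset (Triple ι)).filter (fun t => cnt t = I), F t

variable {n : ℕ}

/-- Real indicator of `x ↔ y` in the open graph of the Boolean edge vector `a` (one replica). [folklore] -/
noncomputable def rch (a : Sym2 (Fin n) → Bool) (x y : Fin n) : ℝ := ir ((openGraph (cfg a)).Reachable x y)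

/-- The summand of the fibre count of (T) at a replica triple:
`N₁ · D₂ · D₃ · (ub₂ − ub₃) · (vo₃ − oc₁ · vc₃)` with `N₁ = [c ↮₁ u][c ↮₁ v]`, `D_k = [u ↮_k v]`. [folklore] -/
noncomputable def summandT (o b u v c : Fin n) (t : Triple (Sym2 (Fin n))) : ℝ :=
  (1 - rch t.1 c u) * (1 - rch t.1 c v) * (1 - rch t.2.1 u v) * (1 - rch t.2.2 u v) *
    (rch t.2.1 u b - rch t.2.2 u b) * (rch t.2.2 v o - rch t.1 o c * rch t.2.2 v c)

/-- Membership of a configuration in a connection event, as a real indicator. [folklore] -/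
theorem ir_mem_openConn (a : Sym2 (Fin n) → Bool) (x y : Fin n) :
    ir (cfg a ∈ (openConn x y : Set (BondConfig (Fin n)))) = rch a x y := rfl

/-- The four-term integrand of `fibreSumT` is `summandT`. [folklore] -/
theorem integrand_eq_summandT (o b u v c : Fin n) (t : Triple (Sym2 (Fin n))) :
    1 * ind ((openConn c u)ᶜ ∩ (openConn c v)ᶜ) ((openConn u v)ᶜ ∩ openConn u b) ((openConn u v)ᶜ ∩ openConn v o) t +
      (-1) * ind ((openConn c u)ᶜ ∩ (openConn c v)ᶜ) (openConn u v)ᶜ ((openConn u v)ᶜ ∩ openConn u b ∩ openConn v o) t +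
      (-1) * ind ((openConn c u)ᶜ ∩ (openConn c v)ᶜ ∩ openConn o c) ((openConn u v)ᶜ ∩ openConn u b) ((openConn u v)ᶜ ∩ openConn v c) t +
      1 * ind ((openConn c u)ᶜ ∩ (openConn c v)ᶜ ∩ openConn o c) (openConn u v)ᶜ ((openConn u v)ᶜ ∩ openConn u b ∩ openConn v c) t =
    summandT o b u v c t := by
  simp only [ind_eq_ir, Set.mem_inter_iff, Set.mem_compl_iff, ir_and, ir_not, ir_mem_openConn]
  unfold summandT
  ring

/-- **`fibreSumT` is the fibre sum of `summandT`.** [folklore] -/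
theorem fibreSumT_eq_fibreSumF (o b u v c : Fin n) (I : Sym2 (Fin n) → ℕ) :
    fibreSumT o b u v c I = fibreSumF (summandT o b u v c) I := by
  unfold fibreSumT fibreSum4 fibreSumF
  exact Finset.sum_congr rfl fun t _ => integrand_eq_summandT o b u v c t

end Summand

/-! ### Coordinate surgery on replica triples and the splitting of a fibre at one edge -/

section Split

variable {ι : Type*} [Fintype ι] [DecidableEq ι]

/-- Set the three replica values at the coordinate `e`. [folklore] -/
def setAt (e : ι) (x y z : Bool) (t : Triple ι) : Triple ι :=
  (Function.update t.1 e x, Function.update t.2.1 e y, Function.update t.2.2 e z)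

omit [Fintype ι] in
/-- First replica after `setAt`. [folklore] -/
theorem setAt_fst (e : ι) (x y z : Bool) (t : Triple ι) : (setAt e x y z t).1 = Function.update t.1 e x := rfl
omit [Fintype ι] in
/-- Second replica after `setAt`. [folklore] -/
theorem setAt_snd_fst (e : ι) (x y z : Bool) (t : Triple ι) : (setAt e x y z t).2.1 = Function.update t.2.1 e y := rfl
omit [Fintype ι] in
/-- Third replica after `setAt`. [folklore] -/
theorem setAt_snd_snd (e : ι) (x y z : Bool) (t : Triple ι) : (setAt e x y z t).2.2 = Function.update t.2.2 e z := rfl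

omit [Fintype ι] in
/-- Setting twice at the same coordinate keeps the last values. [folklore] -/
theorem setAt_setAt (e : ι) (x y z x' y' z' : Bool) (t : Triple ι) :
    setAt e x y z (setAt e x' y' z' t) = setAt e x y z t := by
  unfold setAt; simp only [Function.update_idem]

omit [Fintype ι] in
/-- Setting a coordinate to its own values does nothing. [folklore] -/
theorem setAt_self (e : ι) (t : Triple ι) : setAt e (t.1 e) (t.2.1 e) (t.2.2 e) t = t := by
  unfold setAt; simp only [Function.update_eq_self]

omit [Fintype ι] in
/-- The count vector after setting a coordinate. [folklore] -/
theorem cnt_setAt (e : ι) (x y z : Bool) (t : Triple ι) (i : ι) :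
    cnt (setAt e x y z t) i = if i = e then cnt3 x y z else cnt t i := by
  unfold cnt setAt
  by_cases h : i = e
  · subst h; simp
  · simp [h]

omit [Fintype ι] [DecidableEq ι] in
/-- On the fibre of a count vector vanishing at `e`, all three replicas have `e` closed. [folklore] -/
theorem apply_eq_false_of_cnt_eq_zero {t : Triple ι} {e : ι} (h : cnt t e = 0) :
    t.1 e = false ∧ t.2.1 e = false ∧ t.2.2 e = false := by
  unfold cnt at h; exact (cnt3_eq_zero_iff _ _ _).1 h

omit [Fintype ι] in
/-- A triple with prescribed values at `e` is `setAt` of itself. [folklore] -/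
theorem setAt_eq_self_of_apply {t : Triple ι} {e : ι} {x y z : Bool} (h : t.1 e = x ∧ t.2.1 e = y ∧ t.2.2 e = z) :
    setAt e x y z t = t := by
  obtain ⟨h1, h2, h3⟩ := h
  rw [← h1, ← h2, ← h3]
  exact setAt_self e t

omit [Fintype ι] in
/-- **Re-indexing one pattern.**  The triples of the fibre `S` of `J` whose values at `e` are `(x, y, z)` (where
`cnt3 x y z = J e`) are exactly the images under `setAt e x y z` of the fibre `S₀` of `J[e ↦ 0]`. [folklore] -/
theorem sum_fibre_pattern (F : Triple ι → ℝ) (J : ι → ℕ) (e : ι) (x y z : Bool) (hJ : cnt3 x y z = J e)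
    (S S₀ : Finset (Triple ι)) (hS : ∀ t, t ∈ S ↔ cnt t = J) (hS₀ : ∀ t, t ∈ S₀ ↔ cnt t = Function.update J e 0) :
    ∑ t ∈ S.filter (fun t => (t.1 e, t.2.1 e, t.2.2 e) = (x, y, z)), F t = ∑ t ∈ S₀, F (setAt e x y z t) := by
  symm
  refine Finset.sum_nbij' (setAt e x y z) (setAt e false false false) ?_ ?_ ?_ ?_ ?_
  · -- maps into
    intro t ht
    rw [hS₀] at ht
    rw [Finset.mem_filter, hS]
    refine ⟨?_, by simp [setAt]⟩
    funext i
    rw [cnt_setAt]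
    by_cases hi : i = e
    · rw [if_pos hi, hi, hJ]
    · rw [if_neg hi, ht, Function.update_of_ne hi]
  · -- maps back
    intro t ht
    rw [Finset.mem_filter, hS] at ht
    rw [hS₀]
    funext i
    rw [cnt_setAt]
    by_cases hi : i = e
    · rw [if_pos hi, hi, Function.update_self]; rfl
    · rw [if_neg hi, ht.1, Function.update_of_ne hi]
  · -- left inverse
    intro t ht
    rw [hS₀] at ht
    have h0 : t.1 e = false ∧ t.2.1 e = false ∧ t.2.2 e = false :=
      apply_eq_false_of_cnt_eq_zero (by rw [ht, Function.update_self])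
    rw [setAt_setAt]
    exact setAt_eq_self_of_apply h0
  · -- right inverse
    intro t ht
    rw [Finset.mem_filter] at ht
    have h1 : t.1 e = x ∧ t.2.1 e = y ∧ t.2.2 e = z := by
      have := ht.2; simp only [Prod.mk.injEq] at this; exact this
    rw [setAt_setAt]
    exact setAt_eq_self_of_apply h1
  · intro t _; rfl

/-- **Splitting a fibre at one edge.**  Grouping the fibre of `J` by the replica pattern at `e`. [folklore] -/
theorem fibreSumF_eq_sum_patterns (F : Triple ι → ℝ) (J : ι → ℕ) (e : ι) :
    fibreSumF F J = ∑ p ∈ (Finset.univ : Finset (Bool × Bool × Bool)).filter (fun p => cnt3 p.1 p.2.1 p.2.2 = J e),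
      fibreSumF (fun t => F (setAt e p.1 p.2.1 p.2.2 t)) (Function.update J e 0) := by
  unfold fibreSumF
  refine (Finset.sum_fiberwise_of_maps_to
    (t := (Finset.univ : Finset (Bool × Bool × Bool)).filter (fun p => cnt3 p.1 p.2.1 p.2.2 = J e))
    (g := fun t : Triple ι => (t.1 e, t.2.1 e, t.2.2 e)) ?_ F).symm.trans ?_
  · intro t ht
    simp only [Finset.mem_filter, Finset.mem_univ, true_and] at ht ⊢
    rw [← ht]; rfl
  · refine Finset.sum_congr rfl fun p hp => ?_
    exact sum_fibre_pattern F J e p.1 p.2.1 p.2.2 (Finset.mem_filter.1 hp).2 _ _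
      (fun t => by simp only [Finset.mem_filter, Finset.mem_univ, true_and])
      (fun t => by simp only [Finset.mem_filter, Finset.mem_univ, true_and])

/-- The solo patterns. [folklore] -/
theorem patterns_one : (Finset.univ : Finset (Bool × Bool × Bool)).filter (fun p => cnt3 p.1 p.2.1 p.2.2 = 1) =
    {(true, false, false), (false, true, false), (false, false, true)} := by decide

/-- The duo patterns. [folklore] -/
theorem patterns_two : (Finset.univ : Finset (Bool × Bool × Bool)).filter (fun p => cnt3 p.1 p.2.1 p.2.2 = 2) =
    {(true, true, false), (true, false, true), (false, true, true)} := by decide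

/-- The contracted pattern. [folklore] -/
theorem patterns_three : (Finset.univ : Finset (Bool × Bool × Bool)).filter (fun p => cnt3 p.1 p.2.1 p.2.2 = 3) =
    {(true, true, true)} := by decide

/-- **Solo edge:** the fibre of `J` (`J e = 1`) is the disjoint union of three copies of the fibre of `J[e ↦ 0]`. [folklore] -/
theorem fibreSumF_split_one (F : Triple ι → ℝ) (J : ι → ℕ) (e : ι) (hJ : J e = 1) :
    fibreSumF F J = fibreSumF (fun t => F (setAt e true false false t)) (Function.update J e 0) +
      fibreSumF (fun t => F (setAt e false true false t)) (Function.update J e 0) +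
      fibreSumF (fun t => F (setAt e false false true t)) (Function.update J e 0) := by
  rw [fibreSumF_eq_sum_patterns F J e, hJ, patterns_one, Finset.sum_insert (by decide), Finset.sum_insert (by decide),
    Finset.sum_singleton]
  ring

/-- **Duo edge:** the fibre of `J` (`J e = 2`) is the disjoint union of three copies of the fibre of `J[e ↦ 0]`. [folklore] -/
theorem fibreSumF_split_two (F : Triple ι → ℝ) (J : ι → ℕ) (e : ι) (hJ : J e = 2) :
    fibreSumF F J = fibreSumF (fun t => F (setAt e true true false t)) (Function.update J e 0) +
      fibreSumF (fun t => F (setAt e true false true t)) (Function.update J e 0) +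
      fibreSumF (fun t => F (setAt e false true true t)) (Function.update J e 0) := by
  rw [fibreSumF_eq_sum_patterns F J e, hJ, patterns_two, Finset.sum_insert (by decide), Finset.sum_insert (by decide),
    Finset.sum_singleton]
  ring

/-- **Contracted edge:** the fibre of `J` (`J e = 3`) is a copy of the fibre of `J[e ↦ 0]`. [folklore] -/
theorem fibreSumF_split_three (F : Triple ι → ℝ) (J : ι → ℕ) (e : ι) (hJ : J e = 3) :
    fibreSumF F J = fibreSumF (fun t => F (setAt e true true true t)) (Function.update J e 0) := by
  rw [fibreSumF_eq_sum_patterns F J e, hJ, patterns_three, Finset.sum_singleton]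

omit [DecidableEq ι] in
/-- A summand identity on the fibre of `J` transfers to the fibre sums. [folklore] -/
theorem fibreSumF_congr {F G : Triple ι → ℝ} {J : ι → ℕ} (h : ∀ t, cnt t = J → F t = G t) :
    fibreSumF F J = fibreSumF G J := by
  unfold fibreSumF
  exact Finset.sum_congr rfl fun t ht => h t (Finset.mem_filter.1 ht).2

omit [DecidableEq ι] in
/-- Linearity of the fibre sum. [folklore] -/
theorem fibreSumF_add (F G : Triple ι → ℝ) (J : ι → ℕ) : fibreSumF (fun t => F t + G t) J = fibreSumF F J + fibreSumF G J := by
  unfold fibreSumF; exact Finset.sum_add_distrib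

omit [DecidableEq ι] in
/-- Linearity of the fibre sum. [folklore] -/
theorem fibreSumF_sub (F G : Triple ι → ℝ) (J : ι → ℕ) : fibreSumF (fun t => F t - G t) J = fibreSumF F J - fibreSumF G J := by
  unfold fibreSumF; exact Finset.sum_sub_distrib (f := F) (g := G)

omit [DecidableEq ι] in
/-- Linearity of the fibre sum. [folklore] -/
theorem fibreSumF_mul (a : ℝ) (F : Triple ι → ℝ) (J : ι → ℕ) : fibreSumF (fun t => a * F t) J = a * fibreSumF F J := by
  unfold fibreSumF; rw [Finset.mul_sum]

end Split

end Summit.CriticalPhenomena.PercolationContinuityZ3.Cruxes.AdditiveGluing.TieLine.FibreCount
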